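import Summits.QuantumFields.QCD.Theses.QuarksAsStableAction
import Literature.MathematicalPhysics.QuantumLattice.WilsonDiracAP
import Literature.MathematicalPhysics.QuantumFieldTheory.WilsonSiteRPForm
import Summits.QuantumFields.QCD.Theorems.QuarksAsStableActionUnquenchedChessboardBoundStubDetBound
import Summits.QuantumFields.QCD.Theorems.QuarksAsStableActionUnquenchedChessboardBoundHeavyFloor
import Summits.QuantumFields.QCD.Theorems.QuarksAsStableActionUnquenchedChessboardBoundStubGaugeFloor
import Summits.QuantumFields.QCD.Theorems.QuarksAsStableActionUnquenchedChessboardBoundStubChessboard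
import Summits.QuantumFields.QCD.Theorems.QuarksAsStableActionUnquenchedChessboardBoundStubAxisSwap
import Summits.QuantumFields.QCD.Theorems.QuarksAsStableActionDefs
import Summits.QuantumFields.QCD.Theorems.QuarksAsStableActionUnquenchedChessboardBoundStubShiftZb
import Summits.QuantumFields.QCD.Theorems.QuarksAsStableActionUnquenchedChessboardBoundStubTemporalGauge
import Summits.QuantumFields.QCD.Theorems.QuarksAsStableActionUnquenchedChessboardBoundStubMarginalRP
import Summits.QuantumFields.QCD.Theorems.QuarksAsStableActionUnquenchedChessboardBoundPeelFloor
import Summits.QuantumFields.QCD.Theorems.QuarksAsStableActionUnquenchedChessboardBoundStubAssembly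
import Literature.MathematicalPhysics.QuantumFieldTheory.ConstructiveQFTWave0Proofs

/-!
# Skeleton — crux `UnquenchedChessboardBound` (stmt-QuantumFields-9735), line `Sketch`

Lead's reshaping of the checked line `Sketch` (ideator-2 cards `signed-pattern-chessboard` +
`signed-partition-floor`) into a composition with registered stubs `stub_*`:

* `stub_detBound` — crude Hadamard bound `|det D_AP[U,m]| ≤ (|m+4| + 96)^{12 L⁴}` (pathwise).
* `stub_gaugeFloor` — pure-gauge entropy floor `∫ e^{-β S_W} ∏dU ≥ e^{-(a + εβ)L⁴}` (Haar small ball).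
* `stub_chessboard` — the abstract Fröhlich–Israel–Lieb–Simon chessboard estimate in LETTER form
  on the even four-torus of cells `(ℤ/N)⁴` (every even `N`, alphabet with four commuting
  involutions, a real functional that is translation invariant, reflection non-negative and
  reflection Cauchy–Schwarz in each axis): `|Φ w|^{N⁴} ≤ ∏_c Φ(universal pattern of the letter w c)`.
* `stub_marginalRP` — marginal site-reflection positivity of the SIGNED det-weighted Wilson
  functional in the time axis (planes `t = 0, L/2`, the tree's `GaugeConfig.negReflect` and
  half-observable class `WilsonSiteRP.IsHalfObs`), for all masses `m_f > -1`.
* `stub_axisSwap` — hypercubic covariance: `det D_AP` and `S_W` are invariant under the exchange of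
  the time axis with any axis `i` (so `stub_marginalRP` transports to all four axes).
* `stub_signedFloor` — the floor on the signed un-normalised partition function
  `Re ∫ ∏_f det D_AP[U,m_f] e^{-β S_W(U)} ∏dU ≥ e^{-(a+εβ)L⁴}` on any mass window `⊂ (-1,∞)`
  (HARD; lead's stub; it takes `stub_gaugeFloor` as its pure-gauge hypothesis) — REDUCED (v7) by the
  lead's proved peeling recursion `signedFloor_of_peels` to the wave-2 stubs `stub_torusPeel`,
  `stub_sitePeel` (diluted polarized site Gram CS), `stub_shiftZb` (translation covariance),
  `stub_temporalGauge` + `stub_linkGram` (⇒ `stub_linkPeel`, link Gram CS).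
* `stub_assembly` — dissemination bookkeeping: the five analytic inputs above imply the crux
  (closed-unit-cell letters = sets of bad plaquettes, base-point assignment `≥ |R|/6` cells,
  universal pattern has `≥ L⁴/4` distinct bad plaquettes, normalisation `Z_g` cancels).

`UnquenchedChessboardBound_of` composes them and concludes the crux BY NAME.
-/

noncomputable section

open MeasureTheory Matrix Complex Finset
open Literature.MathematicalPhysics.QuantumFieldTheory Literature.MathematicalPhysics.QuantumLattice
open Summit.QuantumFields.QCD.Theorems.QuarksAsStableAction
open scoped ComplexConjugate BigOperators ComplexOrder

namespace Summit.QuantumFields.QCD.Theorems.UnquenchedChessboardBoundLine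

/-! ## Stub 1 — pathwise determinant bound (Hadamard): LANDED
`stub_detBound` is imported from `QuarksAsStableActionUnquenchedChessboardBoundStubDetBound` (p103173, wave 1). -/

/-! ## Stub 2 — pure-gauge entropy floor (Haar small ball): LANDED
`stub_gaugeFloor` is imported from `QuarksAsStableActionUnquenchedChessboardBoundStubGaugeFloor` (p103687, wave 1). -/

/-! ## Stub 3 — the abstract chessboard estimate (letter form, every even period, four axes): LANDED
`stub_chessboard` is imported from `QuarksAsStableActionUnquenchedChessboardBoundStubChessboard`
(p103508 Aux + p104129, wave 1). -/

/-! ## Stub 4 — marginal site-reflection positivity of the signed functional (time axis): LANDED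
`stub_marginalRP` is imported from `QuarksAsStableActionUnquenchedChessboardBoundStubMarginalRP`
(p112220, wave 1/2, worker w-marginalRP: Gram identity of the chirality-split determinant + PSD shared
kernel + the tree's shared-block mechanism). -/

/-! ## Stub 5 — hypercubic covariance (time axis ↔ axis `i`): LANDED
`stub_axisSwap` is imported from `QuarksAsStableActionUnquenchedChessboardBoundStubAxisSwap`
(Aux + p105313, wave 1). -/

/-! ## Stub 6 — the floor on the SIGNED partition function (lead's stub): REDUCED
`stub_signedFloor` = `QuarksAsStableAction.signedFloor_of_peels hgauge stub_torusPeel stub_sitePeel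
stub_linkPeel stub_shiftZb` (the peeling recursion, PROVED: lead files `…PeelFloorAux.lean`,
`…PeelFloor.lean`, rc 0, landing behind `…DilutedFloorSharp.lean`; the one-line proof replaces the
`sorry` below as soon as `…PeelFloor` is importable). Heavy window `m_lo > 0` landed separately
(`signedFloor_heavy`, p102942). The remaining OPEN inputs are the wave-2 stubs below; `stub_shiftZb` (p110473) and
`stub_temporalGauge` (p110490) have LANDED and are imported. -/

/-- **Stub `torusPeel`** (site reflection `t ↦ -t` in the planes `t = 0`, `t = L/2`; Cauchy–Schwarz
of the polarized Gram identity for the diluted determinant): `0 ≤ Re Zb(univ)` and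
`‖Zb(slab[0, L/2])‖² ≤ Re Zb(univ) · Re Zb(slice 0 ∪ slice L/2)`. -/
theorem stub_torusPeel (Nf L : ℕ) [NeZero L] [Fact (1 < L)] (hL : Even L) (h4 : 4 ≤ L) (β : ℝ)
    (m : Fin Nf → ℝ) (hm : ∀ f, -1 < m f) :
    0 ≤ (∫ U, (∏ f, (bondWilsonDiracAP univ U (m f)).det) *
            (Real.exp (-β * wilsonAction (fundamentalRep (Fin 3)) U) : ℂ)
          ∂(Measure.pi fun _ : Edge 4 L => haarProbability (Matrix.specialUnitaryGroup (Fin 3) ℂ))).re ∧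
      ‖∫ U, (∏ f, (bondWilsonDiracAP (slabBonds 0 (L / 2)) U (m f)).det) *
            (Real.exp (-β * wilsonAction (fundamentalRep (Fin 3)) U) : ℂ)
          ∂(Measure.pi fun _ : Edge 4 L => haarProbability (Matrix.specialUnitaryGroup (Fin 3) ℂ))‖ ^ 2 ≤
        (∫ U, (∏ f, (bondWilsonDiracAP univ U (m f)).det) *
            (Real.exp (-β * wilsonAction (fundamentalRep (Fin 3)) U) : ℂ)
          ∂(Measure.pi fun _ : Edge 4 L => haarProbability (Matrix.specialUnitaryGroup (Fin 3) ℂ))).re *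
        (∫ U, (∏ f, (bondWilsonDiracAP (sliceBonds 0 ∪ sliceBonds ((L / 2 : ℕ) : ZMod L)) U (m f)).det) *
            (Real.exp (-β * wilsonAction (fundamentalRep (Fin 3)) U) : ℂ)
          ∂(Measure.pi fun _ : Edge 4 L => haarProbability (Matrix.specialUnitaryGroup (Fin 3) ℂ))).re := by
  sorry

/-- **Stub `sitePeel`** (site reflection `t ↦ -t` in the planes `t = 0`, `t = L/2`): the closed slab
of the slices `-p, …, p` (even length `2p ≤ L/2`), its upper half `0, …, p` and the middle slice `0`
satisfy `0 ≤ Re Zb(slab[-p, p])` and `‖Zb(slab[0, p])‖² ≤ Re Zb(slab[-p, p]) · Re Zb(slice 0)`. -/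
theorem stub_sitePeel (Nf L : ℕ) [NeZero L] [Fact (1 < L)] (hL : Even L) (h4 : 4 ≤ L) (β : ℝ)
    (m : Fin Nf → ℝ) (hm : ∀ f, -1 < m f) (p : ℕ) (hp : 2 * p ≤ L / 2) :
    0 ≤ (∫ U, (∏ f, (bondWilsonDiracAP (slabBonds (-(p : ZMod L)) (2 * p)) U (m f)).det) *
            (Real.exp (-β * wilsonAction (fundamentalRep (Fin 3)) U) : ℂ)
          ∂(Measure.pi fun _ : Edge 4 L => haarProbability (Matrix.specialUnitaryGroup (Fin 3) ℂ))).re ∧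
      ‖∫ U, (∏ f, (bondWilsonDiracAP (slabBonds 0 p) U (m f)).det) *
            (Real.exp (-β * wilsonAction (fundamentalRep (Fin 3)) U) : ℂ)
          ∂(Measure.pi fun _ : Edge 4 L => haarProbability (Matrix.specialUnitaryGroup (Fin 3) ℂ))‖ ^ 2 ≤
        (∫ U, (∏ f, (bondWilsonDiracAP (slabBonds (-(p : ZMod L)) (2 * p)) U (m f)).det) *
            (Real.exp (-β * wilsonAction (fundamentalRep (Fin 3)) U) : ℂ)
          ∂(Measure.pi fun _ : Edge 4 L => haarProbability (Matrix.specialUnitaryGroup (Fin 3) ℂ))).re *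
        (∫ U, (∏ f, (bondWilsonDiracAP (sliceBonds 0) U (m f)).det) *
            (Real.exp (-β * wilsonAction (fundamentalRep (Fin 3)) U) : ℂ)
          ∂(Measure.pi fun _ : Edge 4 L => haarProbability (Matrix.specialUnitaryGroup (Fin 3) ℂ))).re := by
  sorry

/-- **Stub `linkGram`** (the LINK Gram inequality in the temporal gauge; lead's stub): for the
gauge-fixed integrals `Zc(E) = ∫ ∏_f det D_E[U|_{cross := 1}, m_f] e^{-βS_W(U|_{cross := 1})} ∏dU`,
`0 ≤ Re Zc(slab[-p, p+1])` and `‖Zc(slab[1, p+1])‖² ≤ Re Zc(slab[-p, p+1]) · Re Zc(∅)`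
(`2p + 1 ≤ L/2`, `β ≥ 0`): the inverse-free block expansion of `det` across the crossing layer
(`det_fromBlocks_eq_sum_rho`), the mirror relation `D_lower(U) = Θ D_upper(θU)ᴴ Θ⁻¹`
(`Θ = mirror ⊗ 1 ⊗ γ₀`) and `P₊ P₋ = 0` turn `det D_{A ∪ layer ∪ θB}` into the Gram pairing
`Σ_k g^A_k(U) conj g^B_k(θU)` of complementary minors of the upper blocks (all signs `+`); the
crossing plaquettes at `cross = 1` pair an upper boundary link with its mirror image
(`WilsonRP.sum_coeff_mul_conj` at `Y = 1`), and `LatticeRP.integral_mul_conj_mul_exp_nonneg`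
gives positivity of every `Σ_k |…|²`, whence Cauchy–Schwarz; the pendant layer and the bare layer
are transparent (`det D_{A ∪ layer} = det D_A`, `det D_{layer} = det D_∅`). -/
theorem stub_linkGram (Nf L : ℕ) [NeZero L] [Fact (1 < L)] (hL : Even L) (h4 : 4 ≤ L) (β : ℝ) (hβ : 0 ≤ β)
    (m : Fin Nf → ℝ) (hm : ∀ f, -1 < m f) (p : ℕ) (hp : 2 * p + 1 ≤ L / 2) :
    0 ≤ (∫ U, (∏ f, (bondWilsonDiracAP (slabBonds (-(p : ZMod L)) (2 * p + 1)) (LatticeRP.splice WilsonRP.crossEdges (U, 1)) (m f)).det) *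
            (Real.exp (-β * wilsonAction (fundamentalRep (Fin 3)) (LatticeRP.splice WilsonRP.crossEdges (U, 1))) : ℂ)
          ∂(Measure.pi fun _ : Edge 4 L => haarProbability (Matrix.specialUnitaryGroup (Fin 3) ℂ))).re ∧
      ‖∫ U, (∏ f, (bondWilsonDiracAP (slabBonds 1 p) (LatticeRP.splice WilsonRP.crossEdges (U, 1)) (m f)).det) *
            (Real.exp (-β * wilsonAction (fundamentalRep (Fin 3)) (LatticeRP.splice WilsonRP.crossEdges (U, 1))) : ℂ)
          ∂(Measure.pi fun _ : Edge 4 L => haarProbability (Matrix.specialUnitaryGroup (Fin 3) ℂ))‖ ^ 2 ≤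
        (∫ U, (∏ f, (bondWilsonDiracAP (slabBonds (-(p : ZMod L)) (2 * p + 1)) (LatticeRP.splice WilsonRP.crossEdges (U, 1)) (m f)).det) *
            (Real.exp (-β * wilsonAction (fundamentalRep (Fin 3)) (LatticeRP.splice WilsonRP.crossEdges (U, 1))) : ℂ)
          ∂(Measure.pi fun _ : Edge 4 L => haarProbability (Matrix.specialUnitaryGroup (Fin 3) ℂ))).re *
        (∫ U, (∏ f, (bondWilsonDiracAP ∅ (LatticeRP.splice WilsonRP.crossEdges (U, 1)) (m f)).det) *
            (Real.exp (-β * wilsonAction (fundamentalRep (Fin 3)) (LatticeRP.splice WilsonRP.crossEdges (U, 1))) : ℂ)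
          ∂(Measure.pi fun _ : Edge 4 L => haarProbability (Matrix.specialUnitaryGroup (Fin 3) ℂ))).re := by
  sorry

/-- **`linkPeel`, REDUCED** to `stub_temporalGauge` + `stub_linkGram` (LINK reflection `t ↦ 1 - t` of the tree's `GaugeConfig.timeReflect`, in
the hyperplanes between the slices `0 | 1` and `L/2 | L/2 + 1`, `β ≥ 0`): the closed slab of the
slices `-p, …, p + 1` (odd length `2p + 1 ≤ L/2`) and its upper half `1, …, p + 1` satisfy
`0 ≤ Re Zb(slab[-p, p+1])` and `‖Zb(slab[1, p+1])‖² ≤ Re Zb(slab[-p, p+1]) · Re Zb(∅)` (the link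
Gram identity gives the entries `Zb(slab[1,p+1] ∪ layer 0→1)` and `Zb(layer 0→1)`, which equal
`Zb(slab[1,p+1])` and `Zb(∅)` because a temporal layer hanging on bare sites is transparent at the
level of determinants, `P₊ P₋ = 0`). -/
theorem stub_linkPeel (Nf L : ℕ) [NeZero L] [Fact (1 < L)] (hL : Even L) (h4 : 4 ≤ L) (β : ℝ)
    (hβ : 0 ≤ β) (m : Fin Nf → ℝ) (hm : ∀ f, -1 < m f) (p : ℕ) (hp : 2 * p + 1 ≤ L / 2) :
    0 ≤ (∫ U, (∏ f, (bondWilsonDiracAP (slabBonds (-(p : ZMod L)) (2 * p + 1)) U (m f)).det) *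
            (Real.exp (-β * wilsonAction (fundamentalRep (Fin 3)) U) : ℂ)
          ∂(Measure.pi fun _ : Edge 4 L => haarProbability (Matrix.specialUnitaryGroup (Fin 3) ℂ))).re ∧
      ‖∫ U, (∏ f, (bondWilsonDiracAP (slabBonds 1 p) U (m f)).det) *
            (Real.exp (-β * wilsonAction (fundamentalRep (Fin 3)) U) : ℂ)
          ∂(Measure.pi fun _ : Edge 4 L => haarProbability (Matrix.specialUnitaryGroup (Fin 3) ℂ))‖ ^ 2 ≤
        (∫ U, (∏ f, (bondWilsonDiracAP (slabBonds (-(p : ZMod L)) (2 * p + 1)) U (m f)).det) *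
            (Real.exp (-β * wilsonAction (fundamentalRep (Fin 3)) U) : ℂ)
          ∂(Measure.pi fun _ : Edge 4 L => haarProbability (Matrix.specialUnitaryGroup (Fin 3) ℂ))).re *
        (∫ U, (∏ f, (bondWilsonDiracAP ∅ U (m f)).det) *
            (Real.exp (-β * wilsonAction (fundamentalRep (Fin 3)) U) : ℂ)
          ∂(Measure.pi fun _ : Edge 4 L => haarProbability (Matrix.specialUnitaryGroup (Fin 3) ℂ))).re := by
  obtain ⟨h0, hcs⟩ := stub_linkGram Nf L hL h4 β hβ m hm p hp
  rw [stub_temporalGauge Nf L h4 β m (slabBonds (-(p : ZMod L)) (2 * p + 1)),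
    stub_temporalGauge Nf L h4 β m (slabBonds 1 p), stub_temporalGauge Nf L h4 β m ∅]
  exact ⟨h0, hcs⟩

/-- **Stub `signedFloor`** (the load-bearing analytic input; card `signed-partition-floor`). For every
flavour number, mass window `[m_lo, m_hi] ⊂ (-1, ∞)` and slack `ε > 0` there is `a` such that for
all `β ≥ 0`, all even `L ≥ 4` and all masses in the window,
`Re ∫ ∏_f det D_AP[U, m_f] e^{-β S_W(U)} ∏ₑ dU_e ≥ exp(-(a + εβ) L⁴)`.
Heavy window (`m_lo > 0`): pathwise, `det D_AP[U,m] ≥ m^{12L⁴}` (`D = (m+4)(1-E)`, `‖E‖ ≤ 4/(m+4)`)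
and `stub_gaugeFloor`. Light window (`-1 < m ≤ 0`): Lüscher's transfer operator — the signed
integral is the trace of the `L`-th power of a positive slice operator, floored by the vacuum
Rayleigh quotient via Hilbert–Schmidt doubling and moment log-convexity. -/
theorem stub_signedFloor
    (hgauge : ∀ ε : ℝ, 0 < ε → ∃ a : ℝ, ∀ β : ℝ, 0 ≤ β → ∀ (L : ℕ) [NeZero L],
      Real.exp (-((a + ε * β) * (L : ℝ) ^ 4)) ≤
        ∫ U, Real.exp (-β * wilsonAction (fundamentalRep (Fin 3)) U) ∂(Measure.pi fun _ : Edge 4 L => haarProbability (Matrix.specialUnitaryGroup (Fin 3) ℂ)))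
    (Nf : ℕ) (mlo mhi ε : ℝ) (hmlo : -1 < mlo) (hε : 0 < ε) :
    ∃ a : ℝ, ∀ β : ℝ, 0 ≤ β → ∀ (L : ℕ) [NeZero L], Even L → 4 ≤ L → ∀ m : Fin Nf → ℝ,
      (∀ f, mlo ≤ m f ∧ m f ≤ mhi) →
      Real.exp (-((a + ε * β) * (L : ℝ) ^ 4)) ≤
        (∫ U, (∏ f, (wilsonDiracAP U (m f)).det) * (Real.exp (-β * wilsonAction (fundamentalRep (Fin 3)) U) : ℂ)
          ∂(Measure.pi fun _ : Edge 4 L => haarProbability (Matrix.specialUnitaryGroup (Fin 3) ℂ))).re :=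
  signedFloor_of_peels hgauge
    (fun Nf L _ _ hL h4 β m hm => stub_torusPeel Nf L hL h4 β m hm)
    (fun Nf L _ _ hL h4 β m hm p hp => stub_sitePeel Nf L hL h4 β m hm p hp)
    (fun Nf L _ _ hL h4 β hβ m hm p hp => stub_linkPeel Nf L hL h4 β hβ m hm p hp)
    (fun Nf L _ _ β m a ℓ => stub_shiftZb Nf L β m a ℓ) Nf mlo mhi ε hmlo hε

/-! ## Stub 7 — dissemination bookkeeping (assembly): LANDED
`stub_assembly` is imported from `QuarksAsStableActionUnquenchedChessboardBoundStubAssembly` (p113400,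
worker w-assembly; Aux1–Aux5 p103900, p105346, p111089, p111656, p112100). -/

/-! ## Composition -/

/-- **The crux from the stubs**: `UnquenchedChessboardBound` (stmt-QuantumFields-9735) follows from
`stub_detBound`, `stub_chessboard`, `stub_marginalRP`, `stub_axisSwap`, `stub_signedFloor` by the
dissemination bookkeeping `stub_assembly` (`stub_gaugeFloor` enters through `stub_signedFloor`). -/
theorem UnquenchedChessboardBound_of :
    Summit.QuantumFields.QCD.Theses.QuarksAsStableAction.UnquenchedChessboardBound :=
  stub_assembly (fun U m => stub_detBound U m)
    (fun hN _ _ _ r hr hrc Φ hcyc hpos hcs => stub_chessboard hN r hr hrc Φ hcyc hpos hcs)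
    (fun Nf L _ _ hL h4 β m hm F hF => stub_marginalRP Nf L hL h4 β m hm F hF)
    (fun i U m => stub_axisSwap i U m)
    (fun Nf mlo mhi ε hmlo hε => stub_signedFloor stub_gaugeFloor Nf mlo mhi ε hmlo hε)

end Summit.QuantumFields.QCD.Theorems.UnquenchedChessboardBoundLine

end
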